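import Summits.QuantumFields.YangMills.Theorems.UnitScaleTiltHalvingTopCrossingDictionaryCore
import Summits.QuantumFields.YangMills.Theorems.UnitScaleTiltHalvingP1FlatCoreSupplierInduction
import Summits.QuantumFields.YangMills.Theorems.UnitScaleTiltHalvingHSiteTorusBlocks
import Summits.QuantumFields.YangMills.Theorems.UnitScaleTiltHalvingP1FlatCoreTopDictionary
import Summits.QuantumFields.YangMills.Theorems.UnitScaleTiltHalvingP1FlatCoreTopStepTorus
import Literature.MathematicalPhysics.QuantumFieldTheory.Balaban1983to89.B8SockHFPCubeMember
import Literature.MathematicalPhysics.QuantumFieldTheory.Balaban1983to89.B8Prop6OfThm4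
import HarnessLib

/-!
# `hP1room` PROGRAMME, THIN ROAD γ, (M2′) «mixed-end top (1.42)»: ★★★ THE κf ↔ (84)(86) DICTIONARY AT THE MEMBER — the (a-ROW) of the `H42topCrossT` discharge (FILE B of 2)

Route `UnitScaleTilt`, crux K1 child «MinimiserStabilityRegPr» (stmt-QuantumFields-19200), registered stub `stub_halvingStep` (`BirthV10`), display v7γ ∕ ρ5 door
(★★OWNER RULING g28-№14, LEAD-H ★w5-19200 g7 WORDS 13∕17: «(O2) processed row — the composer v3.3 CALLS the dictionary internally and DISPLAYS the (a-row) as one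
more antecedent of `H42topCrossT`, `θa := 10·Cb`»).  Cell `ym3-torus` (HUMAN RULING D-0037: YM₃ on T³ is rung R3 — NOT d = 4, NOT infinite volume, NOT a mass gap,
NOT the Clay problem), width seat `ym-ust-20520-w5` gen 9.  `--supports stmt-QuantumFields-19200 --as helper`; THEOREMS ONLY (0 `def`, 0 `sorry`); count-neutral;
nothing here claims (M2′), `H42topCrossT`, the stub or the gap.

WHAT.  ★★★`uavg_mul_kf_sub_one_le_of_datum` — in the INTERNAL letters of the k ≥ 2 composer ✓`HalvingHSiteRowsOfSocketsTGammaR.siteRows_of_socketsTγR` (v3.2, :376: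
the datum `gJ u₁ W A κf lam` of ✓`siteDatum_of_T4Tγ_tree` ∕ ✓`siteTop_of_datum_γ`, J3's rows, the (1.29)∕chart-with-size rows at `K − n − 1`, the JOIN ∕ Prop-10
windows at `c_B`, `+ hs₇`, the top step's (1.108), the chart-with-size on `□_k`, the read radius `σ`, the comb length `m₀`, the (E)-window): for every top label
`yc ∈ □_k^{(k)} = cubeLamS … k k k`, `‖(R̄₀(u₁·e^{iλ′}))^{(k)}(yc) · κf(−iλ′∘rep)_k(π_k yc) − 1‖ ≤ θa` for any floor
`θa ≥ 2·(C2p·(40d·c_B + 2α₄)·2α₄ + 640(α₄ + 8(d+2)L·σ + 5ω)ω)`; ★★`uavg_mul_kf_sub_one_le_of_datum_Cb` — the same with `θa := 10·Cb` off the composer's two remainder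
floors `hCblo : C2p·(40d·c_B + α₄)α₄ ≤ Cb` ((214)) and `hCb₀ : 640(α₄ + δ + 5ω)ω ≤ Cb` ((E)) and ONE window `10·Cb ≤ 1` — the v3.3 row
«`∀ yc ∈ cubeLamS … k k k, ‖uavg L 1 (u₁·gaugeExp lam) k yc · κf((−I)•lam ∘ rep) k (π yc) − 1‖ ≤ 10·Cb`» VERBATIM.
MECHANISM: the torus (E) row `hTop121` of ✓`HalvingHSiteTorusBlocks.siteTorusBlocks_of_datum` at `l₀ := (−iλ′)∘rep` (its two rows read off (1.108) at level `k` through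
`rep ∘ π = id` on `Bᵏ(yc)`, ✓`rep_cover_eq_of_mem_cube`) + (S2) ✓`P1FlatCoreTopDictionary.siteAvgIter_comp_rep_coverAt_eq_qprimeIter` give the log domain and
`‖log κf_k(π yc) − Q′_k(−iλ′)(yc)‖ ≤ 640(…)ω`; FILE A's ★★`uavg_product_mul_sub_one_le` at `K − n = m + 1` with N05's glue (✓`hΩ_cubeFam`, ✓`htw_cubeLamS`,
✓`h8lt_cubeLamS`, ✓`h8top_cubeLamS`, ✓`one_inAk`, ✓`h34_of_inAk_univ`, ✓`hAx_of_inAx_one`) does the rest.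
WHY NOT INHABITANT-SIDE (LOCATE-5, bus 02:40:20Z): the closure's ∀-bound read letter `c′` carries only `8·3800((d+2)L)²c′ ≤ 1`, too weak for the glev∕(214) windows
(`C4G 3 L ≥ 6.9·10⁷`) and for the torus comb window `32·d(M′+ρ′)·c′ ≤ 1`; the composer owns both at `c′ = 2L·c⋆`.
HONEST SCOPE: by-name composition + window bookkeeping; nothing of [Balaban1985Averaging] Prop. 10, [Balaban1985RegularSpaces] Prop. 5 ∕ Sect. E ∕ Thm 4, (M2′) or the
stub is proved here.

References: T. Bałaban, CMP **98** (1985) 17–51 [Balaban1985Averaging] ((84)–(86) p.33, (178) p.45, Prop. 10 (203)–(214) p.50); CMP **99** (1985) 75–102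
[Balaban1985RegularSpaces] ((1.29) p.81, (1.78)–(1.79) p.90, (1.108) p.94, (1.112)–(1.121) pp.95–96, (1.131) p.99); CMP **102** (1985) 277–309 [Balaban1985Variational] ((152) p.301).
-/

set_option autoImplicit false

noncomputable section

open scoped BigOperators Matrix.Norms.L2Operator
open NormedSpace
open Complex (I)

namespace Summit.QuantumFields.YangMills.Theorems.HalvingTopCrossingDictionary

open Literature.MathematicalPhysics.QuantumFieldTheory.Balaban1983to89
open B7Prop1Explicit (e expUnit val_expUnit val_inv_expUnit)
open B7Prop2Explicit (unitaryUnits C0 c2')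
open B7Prop3Flat (c3)
open B7Prop10General (C6 C4G utilG)
open B7Prop10Flat (one_le_C5)
open B7Prop9Flat (C5')
open B7Prop1Local (InBox pdevOn clampCfg)
open B7Eq167Flat (InLambda)
open B7Eq170Flat (cj)
open B7Eq92Concrete (mgauge)
open B7Eq84Concrete (uavg)
open B7Eq78Linearization (QprimeIter zdBlocking)
open B7Eq214General (Cgen)
open B8Ineq125Concrete (C2p)
open B8Ineq130 (tlo thi tlo_zero thi_zero)
open B8Ineq132 (covDerivFwd InAk)
open B8Eq119TwistedAxial (Restr129 InAx bgT)
open B8Eq184Proof (gaugeExp cfgExp)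
open B8Lemma1NonAbelian (mulCfg)
open B8Eq140Level (SideTouches)
open B8Eq146AExpansion (iEta)
open B8Thm2LogB (norm_negI_smul)
open B8Eq155JBound (expCfg_iEta_mem_unitaryUnits)
open B8LambdaSpaceKLevel (wt)
open B8Eq178Averages (Qnl Qnl_eq_mlog_utilG utilG_eq_uavg_mul_inv restr129_iff_uavg)
open B8Eq1123Concrete (cj_smul_complex)
open B8Prop5JoinSectE (cjDiff_le_of_weighted)
open B8Prop5SocketDatum (exists_masked_datum restr129_succ_of_truncation sideTouches_of_tower_bond h33_of_inAk hP_of_datum h69_of_datum)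
open B8SockHFPAssembly (inAx_mgauge_expCfg_of_datum)
open B8SectEInLambdaWitness (witness_unitary_of_glev witness_inv_of_unitary eq214_tower_of_witness)
open B8Eq1117KLevel (glev_on_towers_of_axial)
open B8Restr129InversionLocal (uavg_inv_tower_of_witness witness_mul_of207 dom178_tower_of_witness)
open B7Prop2Explicit (avgClosed_unitaryUnits)
open MatrixLog (mlog)
open HalvingTopCrossingDictionaryCore (uavg_product_mul_sub_one_le)
open Literature.MathematicalPhysics.QuantumLattice (blockSites)

/-! ## §2 AT THE MEMBER (composer letters): the torus half by ✓`siteTorusBlocks_of_datum` (E) ∘ (S2), then §1 -/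

section Member

open Literature.MathematicalPhysics.QuantumFieldTheory.Balaban1983to89.T3ContinuumYM3Torus (T3Family)
open B7Prop1Explicit renaming Site → LSite
open B7Prop2SpecialUnitary (specialUnitaryUnits mem_specialUnitaryUnits specialUnitaryUnits_le_unitaryUnits)
open B5Eq118OneStroke (iterBlockOf)
open B8Eq131Cubes (cube gs mem_cube_iff cube_anti)
open B8Eq131CubesAdmissible (cubeFam)
open B8CubeMemberZd (cubeLamS hΩ_cubeFam inBox_sq_of_mem_cubeLamS inBox_tower_iff_under)
open B8SockHFPCubeMember (htw_cubeLamS h8lt_cubeLamS h8top_cubeLamS)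
open B8Prop6OfThm4 (one_inAk)
open B10Eq27TorusAxialLog (rel pull unitsField toUField suIncl gaugeActT axialT)
open B15Eq112TorusCover (lift cover)
open Node00 (coverAt)
open LatticeFieldCalculus (siteAvgIter)
open Summit.QuantumFields.YangMills.Theorems.Prop8ChartDoubleBar (dbarIterU vframeU)
open Summit.QuantumFields.YangMills.Theorems.P1FlatCoreTopTargetRep (rep_cover_eq_of_mem_cube)
open Summit.QuantumFields.YangMills.Theorems.P1FlatCoreTopDictionary (siteAvgIter_comp_rep_coverAt_eq_qprimeIter inBox_tlo_thi_iff_mem_blockSites)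
open Summit.QuantumFields.YangMills.Theorems.P1FlatCoreTopStepTorus (cj_one_apply)
open Summit.QuantumFields.YangMills.Theorems.HalvingHSiteTorusBlocks (siteTorusBlocks_of_datum)
open HalvingP1FlatCoreSupplierInduction (h34_of_inAk_univ hAx_of_inAx_one)

variable {F : T3Family} {n K : ℕ}

/-- ★★★ **THE κf ↔ (84)(86) DICTIONARY AT THE MEMBER, FIRST ORDER WITH REMAINDER** (the (a-row) of the (M2′) assembly, in the composer's internal letters at
the point where ✓`HalvingHSiteRowsOfSocketsTGammaR.siteRows_of_socketsTγR` applies `H42topCrossT`): for every top label `yc ∈ □_k^{(k)} = cubeLamS … k k k`,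
`‖(R̄₀(u₁·e^{iλ′}))^{(k)}(yc) · κf(−iλ′∘rep)_k(π_k yc) − 1‖ ≤ θa` for any floor `θa ≥ 2·(C2p·(40d·c_B + 2α₄)·2α₄ + 640(α₄ + δ + 5ω)ω)` (`δ = 8(d+2)L·σ`,
`ω = dLα₄∕2`), under the window `C2p·(…)·2α₄ + 640(…)ω ≤ ½`.  INPUTS = ✓`restr129_product_of_topRows`'s binders as the composer passes them (J3's rows for `U′`,
the datum's (1.29)∕chart-with-size at `K − n − 1`, the JOIN windows at `c_B`, `+ hs₇`, the top step's (1.108)) and ✓`siteTorusBlocks_of_datum`'s (chart-with-size on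
`□_k` with `c₁`, read radius `σ·L^{−k}`, comb length `m₀`, the tower `κf`, the (E)-window).  PROOF: torus (E) `hTop121` at `l₀ := (−iλ′)∘rep` + (S2)
✓`siteAvgIter_comp_rep_coverAt_eq_qprimeIter` give `‖log κf_k(π yc) − Q′_k(−iλ′)(yc)‖ ≤ 640(…)ω` and the log domain; §1 does the rest.
[cite: Balaban1985Averaging, (84)-(86) p.33, (178) p.45, (207)-(214) p.50; Balaban1985RegularSpaces, (1.29) p.81, (1.78)-(1.79) p.90, (1.108) p.94, (1.112)-(1.121) pp.95-96, (1.131) p.99] -/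
theorem uavg_mul_kf_sub_one_le_of_datum (hnK : n < K) {m : ℕ} (hkm : K - n = m + 1) (x₀ : Site (F.P K) 0)
    {a : LSite (F.P K).d} {M' ρ' : ℕ} (hρ'1 : 1 ≤ ρ') (hρL : (F.P K).L ≤ ρ')
    (ha : ∀ ν, a ν ≤ ((iterBlockOf (K - n) x₀ ν).val : ℤ) ∧ ((iterBlockOf (K - n) x₀ ν).val : ℤ) ≤ a ν + M' - 1)
    (hroomW : 2 * ((F.P K).L ^ (K - n) * (M' + 1) + ρ' * gs (F.P K).L (K - n)) ≤ (F.P K).sitesPerDir 0)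
    (U : GaugeField (F.P K) 0 (Matrix.specialUnitaryGroup (Fin 2) ℂ)) (gJ : GaugeTransf (F.P K) 0 (Matrix.specialUnitaryGroup (Fin 2) ℂ))
    {u₁ : LSite (F.P K).d → (Matrix (Fin 2) (Fin 2) ℂ)ˣ} {W : LSite (F.P K).d → Fin (F.P K).d → (Matrix (Fin 2) (Fin 2) ℂ)ˣ}
    {A : LSite (F.P K).d → Fin (F.P K).d → Matrix (Fin 2) (Fin 2) ℂ}
    (hu₁SU : ∀ z, ((u₁ z : (Matrix (Fin 2) (Fin 2) ℂ)ˣ) : Matrix (Fin 2) (Fin 2) ℂ) ∈ Matrix.specialUnitaryGroup (Fin 2) ℂ)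
    (hW : mgauge (1 : LSite (F.P K).d → Fin (F.P K).d → (Matrix (Fin 2) (Fin 2) ℂ)ˣ) u₁ W = pull (unitsField (toUField (GaugeField.gaugeAct gJ U))) 0)
    -- J3's rows (1–2) for `U′`, Theorem 4's size constant, the datum's (1.29) at `K − n − 1` and chart-with-size on the touched sides (✓`siteDatum_of_T4Tγ_tree`'s letters)
    {ε₀ α₁ B₀ cstar α₄ : ℝ} (hε₀ : 0 < ε₀) (hα₁ : 0 < α₁) (hB₀ : 0 < B₀) (hα₄ : 0 < α₄)
    (hc : cstar = 5 * ((F.P K).d : ℝ) * (F.P K).L * B₀ * (ε₀ + α₁))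
    (hInAk : InAk (F.P K).L (K - n) (((F.L : ℝ)⁻¹) ^ (K - n)) ε₀ (fun _ => (Set.univ : Set (LSite (F.P K).d))) (pull (unitsField (toUField (GaugeField.gaugeAct gJ U))) 0))
    (hInAx : ∀ m', m' ≤ K - n → ∀ Λ : ℕ → Set (LSite (F.P K).d),
      InAx (F.P K).L m' Λ (1 : LSite (F.P K).d → Fin (F.P K).d → (Matrix (Fin 2) (Fin 2) ℂ)ˣ) (pull (unitsField (toUField (GaugeField.gaugeAct gJ U))) 0))
    (h129 : Restr129 (F.P K).L (K - n - 1) (cubeLamS (F.P K).L a M' ρ' (K - n) (K - n - 1)) (1 : LSite (F.P K).d → Fin (F.P K).d → (Matrix (Fin 2) (Fin 2) ℂ)ˣ) u₁)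
    (hdat : ∀ j, j ≤ K - n - 1 → ∀ b ∈ {b : LSite (F.P K).d × Fin (F.P K).d | SideTouches (cubeFam false (F.P K).L a M' ρ' (K - n) j) b.1 b.2},
      W b.1 b.2 = cfgExp (((F.L : ℝ)⁻¹) ^ (K - n)) A b.1 b.2 ∧ IsSelfAdjoint (A b.1 b.2) ∧
        ‖A b.1 b.2‖ ≤ cstar * (((F.P K).L : ℝ) ^ j * ((F.L : ℝ)⁻¹) ^ (K - n))⁻¹)
    -- the JOIN ∕ Prop-10 windows (composer letters)
    {cB : ℝ} (hcBlo : (F.P K).L * cstar ≤ cB)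
    (hα3 : C0 (F.P K).d * ε₀ ≤ 1 / 3) (hα4 : 4 * ε₀ ≤ c2' (F.P K).d (F.P K).L)
    (hsmall : Real.exp (4 * (800 * (((F.P K).d : ℝ) + 1) ^ 2 * (((F.P K).d : ℝ) + 4)) * ε₀) * (1 + 8 * (131072 * (((F.P K).d : ℝ) + 1) ^ 2) * cB) ≤ 2)
    (hc₃ : 2 * cB ≤ c3 (F.P K).d (F.P K).L) (hsc : 2048 * ((F.P K).d : ℝ) * cB ≤ 1) (hα₃' : 40 * (F.P K).d * cB ≤ 1 / 200)
    (hs₁ : 200 * C6 (F.P K).d * (2 * α₄) ≤ 1) (hs₂' : 12000 * (((F.P K).d : ℝ) + 1) * (F.P K).L * (2 * α₄) ≤ 1)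
    (hs₃ : C4G (F.P K).d (F.P K).L * (ε₀ + 40 * (F.P K).d * cB + 4 * (2 * α₄)) ≤ 1)
    (hs₄ : 1024 * (((F.P K).d : ℝ) + 1) * (((F.P K).d : ℝ) + 4) * (F.P K).L ^ 2 * ε₀ ≤ 1)
    (hs₅ : 32 * (((F.P K).d : ℝ) + 1) ^ 2 * C6 (F.P K).d * (F.P K).L ^ 2 * ε₀ ≤ 1)
    (hs₆ : 16 * (F.P K).d * C5' (F.P K).d * C6 (F.P K).d * ((F.P K).L : ℝ) ^ 2 * ε₀ ≤ 1) (hs₇ : 8 * (F.P K).d * C6 (F.P K).d * (F.P K).L * ε₀ ≤ 1)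
    (hprod8 : 2 * C6 (F.P K).d * (40 * (F.P K).d * cB + 4 * α₄) ≤ 1 / 8)
    -- the top step's (1.108) row for `λ′` on the touched sides of every `Ω_j`, `j ≤ K − n`
    {lam : LSite (F.P K).d → Matrix (Fin 2) (Fin 2) ℂ}
    (h108 : ∀ j, j ≤ K - n → ∀ b ∈ {b : LSite (F.P K).d × Fin (F.P K).d | SideTouches ((cubeFam false (F.P K).L a M' ρ' (K - n)) j) b.1 b.2},
      ‖lam b.1‖ ≤ α₄ ∧ wt (F.P K).L (((F.L : ℝ)⁻¹) ^ (K - n)) j * ‖covDerivFwd (((F.L : ℝ)⁻¹) ^ (K - n)) (1 : LSite (F.P K).d → Fin (F.P K).d → (Matrix (Fin 2) (Fin 2) ℂ)ˣ) b.2 lam b.1‖ ≤ α₄)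
    -- the torus side: chart-with-size on `□_k` (`c₁`), read radius `σ`, comb length `m₀`, the tower `κf` of the charted iterate, the (E)-window (✓`siteTorusBlocks_of_datum`'s letters)
    {c₁ : ℝ} (hchartTop : ∀ z ∈ cube (F.P K).L a M' ρ' (K - n) (K - n), ∀ ν : Fin (F.P K).d,
      W z ν = cfgExp (((F.L : ℝ)⁻¹) ^ (K - n)) A z ν ∧ ((F.L : ℝ)⁻¹) ^ (K - n) * ‖A z ν‖ ≤ c₁)
    {σ : ℝ} (hσ0 : 0 ≤ σ) (hc₁ : Real.exp c₁ - 1 ≤ ((F.L : ℝ)⁻¹) ^ (K - n) * σ)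
    (hbudget : 8 * 3800 * ((((F.P K).d + 2) * (F.P K).L : ℕ) : ℝ) ^ 2 * σ ≤ 1)
    {m₀ : ℕ} (hm₀ : (F.P K).d * (M' + ρ') ≤ m₀) (hm : 32 * (m₀ : ℝ) * σ ≤ 1)
    (κf : (Site (F.P K) 0 → Matrix (Fin 2) (Fin 2) ℂ) → (i : ℕ) → GaugeTransf (F.P K) i (Matrix (Fin 2) (Fin 2) ℂ)ˣ)
    (hκfs : ∀ (μ : Site (F.P K) 0 → Matrix (Fin 2) (Fin 2) ℂ) (i : ℕ) (y : Site (F.P K) (i + 1)),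
      κf μ (i + 1) y = (vframeU (gaugeActT (κf μ i) (dbarIterU i (gaugeActT
        (fun s => (u₁ (lift (F.P K) x₀ + rel x₀ s))⁻¹ * Unitary.toUnits (suIncl (gJ s)) : GaugeTransf (F.P K) 0 (Matrix (Fin 2) (Fin 2) ℂ)ˣ)
        (unitsField (toUField U))))) y)⁻¹ * κf μ i (emb y) * vframeU (dbarIterU i (gaugeActT
          (fun s => (u₁ (lift (F.P K) x₀ + rel x₀ s))⁻¹ * Unitary.toUnits (suIncl (gJ s)) : GaugeTransf (F.P K) 0 (Matrix (Fin 2) (Fin 2) ℂ)ˣ) (unitsField (toUField U)))) y)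
    (hκf0 : ∀ (μ : Site (F.P K) 0 → Matrix (Fin 2) (Fin 2) ℂ) (x : Site (F.P K) 0), ((κf μ 0 x : (Matrix (Fin 2) (Fin 2) ℂ)ˣ) : Matrix (Fin 2) (Fin 2) ℂ) = exp (μ x))
    (hr : 160 * (α₄ + 8 * ((((F.P K).d + 2) * (F.P K).L : ℕ) : ℝ) * σ + 11 * (((F.P K).d : ℝ) * (F.P K).L * α₄ / 2)) ≤ 1 / 4)
    -- the remainder floor `θa` and its window
    {θa : ℝ}
    (hθa : 2 * (C2p (F.P K).d * (40 * (F.P K).d * cB + 2 * α₄) * (2 * α₄) +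
      640 * (α₄ + 8 * ((((F.P K).d + 2) * (F.P K).L : ℕ) : ℝ) * σ + 5 * (((F.P K).d : ℝ) * (F.P K).L * α₄ / 2)) * (((F.P K).d : ℝ) * (F.P K).L * α₄ / 2)) ≤ θa)
    (hwinT : C2p (F.P K).d * (40 * (F.P K).d * cB + 2 * α₄) * (2 * α₄) +
      640 * (α₄ + 8 * ((((F.P K).d + 2) * (F.P K).L : ℕ) : ℝ) * σ + 5 * (((F.P K).d : ℝ) * (F.P K).L * α₄ / 2)) * (((F.P K).d : ℝ) * (F.P K).L * α₄ / 2) ≤ 1 / 2) :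
    ∀ yc ∈ cubeLamS (F.P K).L a M' ρ' (K - n) (K - n) (K - n),
      ‖((uavg (F.P K).L (1 : LSite (F.P K).d → Fin (F.P K).d → (Matrix (Fin 2) (Fin 2) ℂ)ˣ) (u₁ * gaugeExp lam) (K - n) yc : (Matrix (Fin 2) (Fin 2) ℂ)ˣ) :
          Matrix (Fin 2) (Fin 2) ℂ) *
        ((κf (((-I) • lam) ∘ fun s : Site (F.P K) 0 => lift (F.P K) x₀ + rel x₀ s) (K - n) (coverAt (F.P K) (K - n) yc) : (Matrix (Fin 2) (Fin 2) ℂ)ˣ) :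
          Matrix (Fin 2) (Fin 2) ℂ) - 1‖ ≤ θa := by
  letI : CStarAlgebra (Matrix (Fin 2) (Fin 2) ℂ) := B10Eq29TubeLine.cstarAlgebraMatrix 2
  intro yc hyc
  have hd2 : 2 ≤ (F.P K).d := by rw [T3Family.P_d F K]; norm_num
  have hL2 : 2 ≤ (F.P K).L := (F.P K).hL.2
  have hL1 : 1 ≤ (F.P K).L := le_trans (by norm_num) hL2
  have hLF : (F.P K).L = F.L := rfl
  have hk : K - n ≤ (F.P K).m + (F.P K).K := FlatMinimizerH.le_T3 F n K
  have hL0 : (F.L : ℝ) ≠ 0 := Nat.cast_ne_zero.2 (by have := F.hL.2; omega)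
  have hLpos : (0 : ℝ) < F.L := by have := F.hL.2; exact_mod_cast (by omega : 0 < F.L)
  have hηpos : 0 < ((F.L : ℝ)⁻¹) ^ (K - n) := by positivity
  have hη0 : 0 ≤ ((F.L : ℝ)⁻¹) ^ (K - n) := hηpos.le
  -- the read radius `s₀ := L^{−k}·σ`, `L^k·s₀ = σ`
  have hLs1 : ((F.P K).L : ℝ) ^ (K - n) * (((F.L : ℝ)⁻¹) ^ (K - n) * σ) = σ := by
    rw [hLF, ← mul_assoc, ← mul_pow, mul_inv_cancel₀ hL0, one_pow, one_mul]
  have hs₀0 : 0 ≤ ((F.L : ℝ)⁻¹) ^ (K - n) * σ := by positivity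
  have hbudget' : 8 * 3800 * ((((F.P K).d + 2) * (F.P K).L : ℕ) : ℝ) ^ 2 * ((F.P K).L : ℝ) ^ (K - n) * (((F.L : ℝ)⁻¹) ^ (K - n) * σ) ≤ 1 := by
    rw [mul_assoc (8 * 3800 * ((((F.P K).d + 2) * (F.P K).L : ℕ) : ℝ) ^ 2), hLs1]; exact hbudget
  have hm' : 32 * (m₀ : ℝ) * (((F.P K).L : ℝ) ^ (K - n) * (((F.L : ℝ)⁻¹) ^ (K - n) * σ)) ≤ 1 := by rw [hLs1]; exact hm
  have hr' : 160 * (α₄ + 8 * ((((F.P K).d + 2) * (F.P K).L : ℕ) : ℝ) * ((F.P K).L : ℝ) ^ (K - n) * (((F.L : ℝ)⁻¹) ^ (K - n) * σ) +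
      11 * (((F.P K).d : ℝ) * (F.P K).L * α₄ / 2)) ≤ 1 / 4 := by
    rw [mul_assoc (8 * ((((F.P K).d + 2) * (F.P K).L : ℕ) : ℝ)), hLs1]; exact hr
  -- the torus (E) rows of ✓`siteTorusBlocks_of_datum` at the read radius `s₀`
  obtain ⟨-, -, hE, -, -, -⟩ := siteTorusBlocks_of_datum hnK x₀ hρ'1 ha hroomW U gJ hu₁SU hW hη0 hchartTop _ rfl hs₀0 hc₁ hbudget' hm₀ hm' κf
    hκfs hκf0 hα₄ hr'
  -- `rep ∘ π = id` on the tower of `yc` (the door's left inverse on `□₀ ⊇ □_k ⊇ Bᵏ(yc)`)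
  have hrep : ∀ x : LSite (F.P K).d, InBox (tlo (F.P K).L yc (K - n)) (thi (F.P K).L yc (K - n)) x →
      lift (F.P K) x₀ + rel x₀ (cover (F.P K) x) = x := fun x hx =>
    rep_cover_eq_of_mem_cube hk x₀ ha hroomW (cube_anti (Nat.zero_le _) le_rfl
      ((mem_cube_iff hL1).2 ⟨yc, inBox_sq_of_mem_cubeLamS hyc, (inBox_tower_iff_under (F.P K).L (K - n) yc x).1 hx⟩))
  -- the two rows of `l₀ := (−iλ′) ∘ rep` on the tower, from (1.108) at level `k` (the tower bonds side-touch `Ω_k`)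
  have hST : ∀ (x : LSite (F.P K).d) (κ : Fin (F.P K).d), InBox (tlo (F.P K).L yc (K - n)) (thi (F.P K).L yc (K - n)) x →
      SideTouches (cubeFam false (F.P K).L a M' ρ' (K - n) (K - n)) x κ :=
    fun x κ hx => sideTouches_of_tower_bond hd2 (htw_cubeLamS hL1 a M' ρ' (K - n) (K - n) le_rfl) le_rfl hyc x κ hx
  have hκ₀ : Fin (F.P K).d := ⟨0, by omega⟩
  have hb : ∀ x : LSite (F.P K).d, InBox (tlo (F.P K).L yc (K - n)) (thi (F.P K).L yc (K - n)) x →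
      ‖(((-I) • lam) ∘ fun s : Site (F.P K) 0 => lift (F.P K) x₀ + rel x₀ s) (cover (F.P K) x)‖ ≤ α₄ := by
    intro x hx
    rw [Function.comp_apply, hrep x hx, Pi.smul_apply, norm_negI_smul]
    have h : ‖lam x‖ ≤ α₄ := (h108 (K - n) le_rfl (x, hκ₀) (hST x hκ₀ hx)).1
    exact h
  have hg : ∀ (x : LSite (F.P K).d) (κ : Fin (F.P K).d), InBox (tlo (F.P K).L yc (K - n)) (thi (F.P K).L yc (K - n)) x →
      InBox (tlo (F.P K).L yc (K - n)) (thi (F.P K).L yc (K - n)) (x + e κ) →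
      ‖(((-I) • lam) ∘ fun s : Site (F.P K) 0 => lift (F.P K) x₀ + rel x₀ s) (cover (F.P K) (x + e κ)) -
          (((-I) • lam) ∘ fun s : Site (F.P K) 0 => lift (F.P K) x₀ + rel x₀ s) (cover (F.P K) x)‖ ≤
        α₄ * (((F.P K).L : ℝ) ^ (K - n))⁻¹ := by
    intro x κ hx hxe
    rw [Function.comp_apply, Function.comp_apply, hrep _ hxe, hrep x hx, Pi.smul_apply, Pi.smul_apply, ← smul_sub, norm_negI_smul]
    have hgrad : wt (F.P K).L (((F.L : ℝ)⁻¹) ^ (K - n)) (K - n) *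
        ‖covDerivFwd (((F.L : ℝ)⁻¹) ^ (K - n)) (1 : LSite (F.P K).d → Fin (F.P K).d → (Matrix (Fin 2) (Fin 2) ℂ)ˣ) κ lam x‖ ≤ α₄ :=
      (h108 (K - n) le_rfl (x, κ) (hST x κ hx)).2
    have h : ‖cj ((1 : LSite (F.P K).d → Fin (F.P K).d → (Matrix (Fin 2) (Fin 2) ℂ)ˣ) x κ) (lam (x + e κ)) - lam x‖ ≤
        α₄ * (((F.P K).L : ℝ) ^ (K - n))⁻¹ := cjDiff_le_of_weighted hL1 hηpos hgrad
    rw [Pi.one_apply, Pi.one_apply, cj_one_apply] at h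
    exact h
  obtain ⟨hVexp, hVQ⟩ := hE yc hyc _ hb hg
  -- (S2): the torus site average of `μ ∘ rep` at `π_k yc` is N05's `Q′_k μ (yc)`
  have hS2 := siteAvgIter_comp_rep_coverAt_eq_qprimeIter hk ((-I) • lam) (fun s : Site (F.P K) 0 => lift (F.P K) x₀ + rel x₀ s) yc
    (fun x hx => hrep x ((inBox_tlo_thi_iff_mem_blockSites hL1 (K - n) yc x).2 hx))
  rw [hS2, mul_assoc (8 * ((((F.P K).d + 2) * (F.P K).L : ℕ) : ℝ)), hLs1] at hVQ
  -- §1 at `m + 1`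
  have hmK : K - n - 1 = m := by omega
  rw [hmK] at h129 hdat
  rw [hkm] at hInAk hInAx h129 hdat h108 hyc hVexp hVQ hηpos
  rw [hkm]
  have hu₁ : ∀ x, u₁ x ∈ unitaryUnits (Matrix (Fin 2) (Fin 2) ℂ) := fun x =>
    specialUnitaryUnits_le_unitaryUnits (mem_specialUnitaryUnits.2 (hu₁SU x))
  have hcore := uavg_product_mul_sub_one_le (𝔸 := Matrix (Fin 2) (Fin 2) ℂ) hd2 hL2 hηpos
    (hΩ_cubeFam hL1 a M' hρL (m + 1)) (lt_add_one m)
    (htw_cubeLamS hL1 a M' ρ' (m + 1) (m + 1) le_rfl)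
    (h8lt_cubeLamS (F.P K).L a M' ρ' (m + 1) m (lt_add_one m)) (h8top_cubeLamS hL1 a M' ρ' (m + 1) m (lt_add_one m))
    hε₀ hα₁ hB₀ hα₄ hc
    (one_inAk hL1 (m + 1) hηpos hε₀ _) (h34_of_inAk_univ hInAk _) (hAx_of_inAx_one hInAx _)
    hu₁ hW h129 hdat hcBlo hα3 hα4 hsmall hc₃ hsc hα₃' hs₁ hs₂' hs₃ hs₄ hs₅ hs₆ hs₇ hprod8 h108
    hyc hVexp hVQ hwinT
  exact hcore.trans hθa

/-- ★★ **THE v3.3 ROW VERBATIM, `θa := 10·Cb`**: `uavg_mul_kf_sub_one_le_of_datum` with the floor and the window discharged from the composer's own letters — the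
torus letters `δ = 8(d+2)L·σ`, `ω = dLα₄∕2` (defining equations), the (E)-window `hr`, and the two remainder floors `hCblo : C2p·(40d·c_B + α₄)·α₄ ≤ Cb` ((214),
✓`siteRows_of_socketsTγR`'s binder) and `hCb₀ : 640(α₄ + δ + 5ω)ω ≤ Cb` ((E)), plus ONE window `10·Cb ≤ 1`:
`2·(C2p(40d·c_B + 2α₄)·2α₄ + 640(α₄+δ+5ω)ω) ≤ 2·(4Cb + Cb) = 10·Cb` and `C2p(…)·2α₄ + 640(…)ω ≤ 5Cb ≤ ½`.
[cite: Balaban1985Averaging, (84)-(86) p.33, (214) p.50; Balaban1985RegularSpaces, (1.121) p.96, (1.131) p.99] -/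
theorem uavg_mul_kf_sub_one_le_of_datum_Cb (hnK : n < K) {m : ℕ} (hkm : K - n = m + 1) (x₀ : Site (F.P K) 0)
    {a : LSite (F.P K).d} {M' ρ' : ℕ} (hρ'1 : 1 ≤ ρ') (hρL : (F.P K).L ≤ ρ')
    (ha : ∀ ν, a ν ≤ ((iterBlockOf (K - n) x₀ ν).val : ℤ) ∧ ((iterBlockOf (K - n) x₀ ν).val : ℤ) ≤ a ν + M' - 1)
    (hroomW : 2 * ((F.P K).L ^ (K - n) * (M' + 1) + ρ' * gs (F.P K).L (K - n)) ≤ (F.P K).sitesPerDir 0)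
    (U : GaugeField (F.P K) 0 (Matrix.specialUnitaryGroup (Fin 2) ℂ)) (gJ : GaugeTransf (F.P K) 0 (Matrix.specialUnitaryGroup (Fin 2) ℂ))
    {u₁ : LSite (F.P K).d → (Matrix (Fin 2) (Fin 2) ℂ)ˣ} {W : LSite (F.P K).d → Fin (F.P K).d → (Matrix (Fin 2) (Fin 2) ℂ)ˣ}
    {A : LSite (F.P K).d → Fin (F.P K).d → Matrix (Fin 2) (Fin 2) ℂ}
    (hu₁SU : ∀ z, ((u₁ z : (Matrix (Fin 2) (Fin 2) ℂ)ˣ) : Matrix (Fin 2) (Fin 2) ℂ) ∈ Matrix.specialUnitaryGroup (Fin 2) ℂ)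
    (hW : mgauge (1 : LSite (F.P K).d → Fin (F.P K).d → (Matrix (Fin 2) (Fin 2) ℂ)ˣ) u₁ W = pull (unitsField (toUField (GaugeField.gaugeAct gJ U))) 0)
    {ε₀ α₁ B₀ cstar α₄ : ℝ} (hε₀ : 0 < ε₀) (hα₁ : 0 < α₁) (hB₀ : 0 < B₀) (hα₄ : 0 < α₄)
    (hc : cstar = 5 * ((F.P K).d : ℝ) * (F.P K).L * B₀ * (ε₀ + α₁))
    (hInAk : InAk (F.P K).L (K - n) (((F.L : ℝ)⁻¹) ^ (K - n)) ε₀ (fun _ => (Set.univ : Set (LSite (F.P K).d))) (pull (unitsField (toUField (GaugeField.gaugeAct gJ U))) 0))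
    (hInAx : ∀ m', m' ≤ K - n → ∀ Λ : ℕ → Set (LSite (F.P K).d),
      InAx (F.P K).L m' Λ (1 : LSite (F.P K).d → Fin (F.P K).d → (Matrix (Fin 2) (Fin 2) ℂ)ˣ) (pull (unitsField (toUField (GaugeField.gaugeAct gJ U))) 0))
    (h129 : Restr129 (F.P K).L (K - n - 1) (cubeLamS (F.P K).L a M' ρ' (K - n) (K - n - 1)) (1 : LSite (F.P K).d → Fin (F.P K).d → (Matrix (Fin 2) (Fin 2) ℂ)ˣ) u₁)
    (hdat : ∀ j, j ≤ K - n - 1 → ∀ b ∈ {b : LSite (F.P K).d × Fin (F.P K).d | SideTouches (cubeFam false (F.P K).L a M' ρ' (K - n) j) b.1 b.2},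
      W b.1 b.2 = cfgExp (((F.L : ℝ)⁻¹) ^ (K - n)) A b.1 b.2 ∧ IsSelfAdjoint (A b.1 b.2) ∧
        ‖A b.1 b.2‖ ≤ cstar * (((F.P K).L : ℝ) ^ j * ((F.L : ℝ)⁻¹) ^ (K - n))⁻¹)
    {cB : ℝ} (hcBlo : (F.P K).L * cstar ≤ cB)
    (hα3 : C0 (F.P K).d * ε₀ ≤ 1 / 3) (hα4 : 4 * ε₀ ≤ c2' (F.P K).d (F.P K).L)
    (hsmall : Real.exp (4 * (800 * (((F.P K).d : ℝ) + 1) ^ 2 * (((F.P K).d : ℝ) + 4)) * ε₀) * (1 + 8 * (131072 * (((F.P K).d : ℝ) + 1) ^ 2) * cB) ≤ 2)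
    (hc₃ : 2 * cB ≤ c3 (F.P K).d (F.P K).L) (hsc : 2048 * ((F.P K).d : ℝ) * cB ≤ 1) (hα₃' : 40 * (F.P K).d * cB ≤ 1 / 200)
    (hs₁ : 200 * C6 (F.P K).d * (2 * α₄) ≤ 1) (hs₂' : 12000 * (((F.P K).d : ℝ) + 1) * (F.P K).L * (2 * α₄) ≤ 1)
    (hs₃ : C4G (F.P K).d (F.P K).L * (ε₀ + 40 * (F.P K).d * cB + 4 * (2 * α₄)) ≤ 1)
    (hs₄ : 1024 * (((F.P K).d : ℝ) + 1) * (((F.P K).d : ℝ) + 4) * (F.P K).L ^ 2 * ε₀ ≤ 1)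
    (hs₅ : 32 * (((F.P K).d : ℝ) + 1) ^ 2 * C6 (F.P K).d * (F.P K).L ^ 2 * ε₀ ≤ 1)
    (hs₆ : 16 * (F.P K).d * C5' (F.P K).d * C6 (F.P K).d * ((F.P K).L : ℝ) ^ 2 * ε₀ ≤ 1) (hs₇ : 8 * (F.P K).d * C6 (F.P K).d * (F.P K).L * ε₀ ≤ 1)
    (hprod8 : 2 * C6 (F.P K).d * (40 * (F.P K).d * cB + 4 * α₄) ≤ 1 / 8)
    {lam : LSite (F.P K).d → Matrix (Fin 2) (Fin 2) ℂ}
    (h108 : ∀ j, j ≤ K - n → ∀ b ∈ {b : LSite (F.P K).d × Fin (F.P K).d | SideTouches ((cubeFam false (F.P K).L a M' ρ' (K - n)) j) b.1 b.2},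
      ‖lam b.1‖ ≤ α₄ ∧ wt (F.P K).L (((F.L : ℝ)⁻¹) ^ (K - n)) j * ‖covDerivFwd (((F.L : ℝ)⁻¹) ^ (K - n)) (1 : LSite (F.P K).d → Fin (F.P K).d → (Matrix (Fin 2) (Fin 2) ℂ)ˣ) b.2 lam b.1‖ ≤ α₄)
    {c₁ : ℝ} (hchartTop : ∀ z ∈ cube (F.P K).L a M' ρ' (K - n) (K - n), ∀ ν : Fin (F.P K).d,
      W z ν = cfgExp (((F.L : ℝ)⁻¹) ^ (K - n)) A z ν ∧ ((F.L : ℝ)⁻¹) ^ (K - n) * ‖A z ν‖ ≤ c₁)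
    {σ δ ω : ℝ} (hσ0 : 0 ≤ σ) (hc₁ : Real.exp c₁ - 1 ≤ ((F.L : ℝ)⁻¹) ^ (K - n) * σ)
    (hδ : δ = 8 * ((((F.P K).d + 2) * (F.P K).L : ℕ) : ℝ) * σ) (hω : ω = ((F.P K).d : ℝ) * (F.P K).L * α₄ / 2)
    (hbudget : 8 * 3800 * ((((F.P K).d + 2) * (F.P K).L : ℕ) : ℝ) ^ 2 * σ ≤ 1)
    {m₀ : ℕ} (hm₀ : (F.P K).d * (M' + ρ') ≤ m₀) (hm : 32 * (m₀ : ℝ) * σ ≤ 1)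
    (κf : (Site (F.P K) 0 → Matrix (Fin 2) (Fin 2) ℂ) → (i : ℕ) → GaugeTransf (F.P K) i (Matrix (Fin 2) (Fin 2) ℂ)ˣ)
    (hκfs : ∀ (μ : Site (F.P K) 0 → Matrix (Fin 2) (Fin 2) ℂ) (i : ℕ) (y : Site (F.P K) (i + 1)),
      κf μ (i + 1) y = (vframeU (gaugeActT (κf μ i) (dbarIterU i (gaugeActT
        (fun s => (u₁ (lift (F.P K) x₀ + rel x₀ s))⁻¹ * Unitary.toUnits (suIncl (gJ s)) : GaugeTransf (F.P K) 0 (Matrix (Fin 2) (Fin 2) ℂ)ˣ)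
        (unitsField (toUField U))))) y)⁻¹ * κf μ i (emb y) * vframeU (dbarIterU i (gaugeActT
          (fun s => (u₁ (lift (F.P K) x₀ + rel x₀ s))⁻¹ * Unitary.toUnits (suIncl (gJ s)) : GaugeTransf (F.P K) 0 (Matrix (Fin 2) (Fin 2) ℂ)ˣ) (unitsField (toUField U)))) y)
    (hκf0 : ∀ (μ : Site (F.P K) 0 → Matrix (Fin 2) (Fin 2) ℂ) (x : Site (F.P K) 0), ((κf μ 0 x : (Matrix (Fin 2) (Fin 2) ℂ)ˣ) : Matrix (Fin 2) (Fin 2) ℂ) = exp (μ x))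
    (hr : 160 * (α₄ + δ + 11 * ω) ≤ 1 / 4)
    -- the composer's two remainder floors ((214) and (E)) and the one window
    {Cb : ℝ} (hCblo : C2p (F.P K).d * (40 * (F.P K).d * cB + α₄) * α₄ ≤ Cb) (hCb₀ : 640 * (α₄ + δ + 5 * ω) * ω ≤ Cb) (hCb10 : 10 * Cb ≤ 1) :
    ∀ yc ∈ cubeLamS (F.P K).L a M' ρ' (K - n) (K - n) (K - n),
      ‖((uavg (F.P K).L (1 : LSite (F.P K).d → Fin (F.P K).d → (Matrix (Fin 2) (Fin 2) ℂ)ˣ) (u₁ * gaugeExp lam) (K - n) yc : (Matrix (Fin 2) (Fin 2) ℂ)ˣ) :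
          Matrix (Fin 2) (Fin 2) ℂ) *
        ((κf (((-I) • lam) ∘ fun s : Site (F.P K) 0 => lift (F.P K) x₀ + rel x₀ s) (K - n) (coverAt (F.P K) (K - n) yc) : (Matrix (Fin 2) (Fin 2) ℂ)ˣ) :
          Matrix (Fin 2) (Fin 2) ℂ) - 1‖ ≤ 10 * Cb := by
  subst hδ hω
  have hL1 : 1 ≤ (F.P K).L := le_trans (by norm_num) (F.P K).hL.2
  have hLr1 : (1 : ℝ) ≤ (F.P K).L := by exact_mod_cast hL1
  have hcs0 : 0 ≤ cstar := by rw [hc]; positivity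
  have hcB0 : 0 ≤ cB := le_trans (by positivity) hcBlo
  have hC2p : 0 ≤ C2p (F.P K).d := B8Ineq125Concrete.C2p_nonneg _
  have hd0 : (0 : ℝ) ≤ (F.P K).d := Nat.cast_nonneg _
  -- `C2p·(40d·c_B + 2α₄)·2α₄ ≤ 4·Cb`
  have h4 : C2p (F.P K).d * (40 * (F.P K).d * cB + 2 * α₄) * (2 * α₄) ≤ 4 * Cb := by
    have hmono : C2p (F.P K).d * (40 * (F.P K).d * cB + 2 * α₄) * (2 * α₄) ≤ 4 * (C2p (F.P K).d * (40 * (F.P K).d * cB + α₄) * α₄) := by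
      have hx : 0 ≤ C2p (F.P K).d * (40 * (F.P K).d * cB) * α₄ := by positivity
      nlinarith only [hx, hC2p, hα₄.le, hcB0, hd0]
    linarith only [hmono, hCblo]
  exact uavg_mul_kf_sub_one_le_of_datum hnK hkm x₀ hρ'1 hρL ha hroomW U gJ hu₁SU hW hε₀ hα₁ hB₀ hα₄ hc hInAk hInAx h129 hdat hcBlo hα3 hα4 hsmall hc₃
    hsc hα₃' hs₁ hs₂' hs₃ hs₄ hs₅ hs₆ hs₇ hprod8 h108 hchartTop hσ0 hc₁ hbudget hm₀ hm κf hκfs hκf0 hr (by linarith only [h4, hCb₀])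
    (by linarith only [h4, hCb₀, hCb10])

end Member

end Summit.QuantumFields.YangMills.Theorems.HalvingTopCrossingDictionary

end
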